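import Literature.NumberTheory.EllipticCurves.PadicSigmaSqTwistTransportProofs
import Literature.NumberTheory.EllipticCurves.PadicSigmaSqMinusTwist
import Literature.NumberTheory.EllipticCurves.FormalInvXExpansionProofs
import Literature.NumberTheory.EllipticCurves.CanonicalPAdicHeightSqOfPairExistenceProofs
import Mathlib.FieldTheory.IsAlgClosed.AlgebraicClosure
import HarnessLib

/-!
# The integral model of a quadratic twist: its sigma-squared pair at `p` and the value dictionary
# (proofs only)

Topic `Literature/NumberTheory/EllipticCurves` (trunk T-NT-EC). Pure proof file (no definition, no
named fact), sequel of `PadicSigmaSqTwistTransportProofs.lean`. Width seat `bsd-line-cf2-p1-w5` (g20)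
of the cell `bsd-print-cf2`, in support of stmt-BirchSwinnertonDyer-20368 (road (C) `disegni-pair-two`,
pinning stub `stub_pin_minusTwist_two`: a canonical `2`-adic height datum on `V^{(d)}`, `d ∈ {−1, ±2}`,
for `V` good ordinary at `2`). BSD is not proved by any of this.

## Content

For `V/ℚ` and `d ∈ ℤ ∖ {0}` the tree's twist model `V.quadraticTwist d` (Rubin–Silverberg:
`y² = x³ + d(b₂/4)x² + d²(b₄/2)x + d³(b₆/4)`) is not integral at `2`; rescaling by `(u,r,s,t) = (2,0,0,0)`
(`x = 4x'`, `y = 8y'`) gives the INTEGRAL TWIST MODEL `W : y² = x³ + d b₂x² + 8d²b₄x + 16d³b₆`, i.e. the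
`W` with `(2,0,0,0) • W = V.quadraticTwist d` (no definition is introduced; `W` is a variable constrained
by this equation, the consumer takes `W := (2,0,0,0)⁻¹ • V.quadraticTwist d`).

* §1 `coeffs_of_scaleTwo_smul_eq`, `isElliptic_of_scaleTwo_smul_eq`, `isIntegral_of_scaleTwo_smul_eq`;
* §2 `twist_variableChange_smul_map_eq` — over any field `K ∋ e`, `e² = d`:
  **`(2e, 0, e·a₁, 4e³·a₃) • W_K = V_K`** (`x_V = x_W/(4d)`);
* §3 `isMazurTateSigmaSqPair_twistModel`, `isMazurTateSigmaSqPair_twistModel_padicSigmaSqInvX` — **at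
  every prime `p` at which `V ⊗ ℚ_p` has a sigma-squared pair, `W ⊗ ℚ_p` carries the sigma-squared
  pair `((4d)⁻¹·𝔖_p(4d/x_W), 4d·c_p)`**, `𝔖_p = padicSigmaSqInvX V p` the `x⁻¹`-expansion of `Σ_p`
  (transport over `\overline{ℚ_p}`); this holds although `W` is ADDITIVE at `p ∣ 2d`;
* §4 the value dictionary at points of `E₁(ℚ_p)`: `padicEval_formalInvX_eq` (`(1/x)(z(P)) = 1/x(P)`),
  `padicEval_rescale_subst_formalInvX_eq` (**`((4d)⁻¹𝔖(4d/x))(z(P)) = (4d)⁻¹·𝔖_p(4d/x(P))`**).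

Sequel: `PadicSigmaSqMinusTwistPinningProofs.lean` (the height datum on `V.quadraticTwist d` pinned to
`canonicalPAdicHeightSqMinusTwist`).

## Sources

* B. Mazur, J. Tate, Duke Math. J. 62 (1991), §3, Thm. 3.1. [MazurTate1991]
* J. H. Silverman, Math. Ann. 332 (2005), §5 Rem. 2. [Silverman2005DivPoly]
* J. H. Silverman, *The Arithmetic of Elliptic Curves*, 2nd ed. (2009), III.1 Table 3.1, IV.1, VII.2.2,
  X.2 Prop. 2.4, X.5 Cor. 5.4. [SilvermanAEC2009]
* K. Rubin, A. Silverberg, Bull. AMS 39 (2002), §1. [RubinSilverberg2002]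
-/

noncomputable section

open scoped Classical
open PowerSeries Literature.NumberTheory.EllipticCurves

namespace WeierstrassCurve

/-! ### §1 The model `W` with `(2, 0, 0, 0) • W = V^{(d)}`: coefficients, ellipticity, integrality -/

section Model

variable (V : WeierstrassCurve ℚ) (d : ℤ) (W : WeierstrassCurve ℚ)

/-- **The coefficients of the integral twist model.** If `(2, 0, 0, 0) • W = V.quadraticTwist d`
(`x = 4x'`, `y = 8y'`), then `W : y² = x³ + d b₂ x² + 8d² b₄ x + 16d³ b₆` (`bᵢ` of `V`).
[Silverman AEC III.1 Table 3.1; X.5 Cor. 5.4] [cite: SilvermanAEC2009, III.1 Table 3.1] -/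
theorem coeffs_of_scaleTwo_smul_eq
    (hW : (⟨Units.mk0 (2 : ℚ) two_ne_zero, 0, 0, 0⟩ : VariableChange ℚ) • W = V.quadraticTwist (d : ℚ)) :
    W.a₁ = 0 ∧ W.a₂ = d * V.b₂ ∧ W.a₃ = 0 ∧ W.a₄ = 8 * d ^ 2 * V.b₄ ∧ W.a₆ = 16 * d ^ 3 * V.b₆ := by
  have h1 := congrArg WeierstrassCurve.a₁ hW
  have h2 := congrArg WeierstrassCurve.a₂ hW
  have h3 := congrArg WeierstrassCurve.a₃ hW
  have h4 := congrArg WeierstrassCurve.a₄ hW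
  have h6 := congrArg WeierstrassCurve.a₆ hW
  simp only [variableChange_a₁, variableChange_a₂, variableChange_a₃, variableChange_a₄, variableChange_a₆,
    quadraticTwist_a₁, quadraticTwist_a₂, quadraticTwist_a₃, quadraticTwist_a₄, quadraticTwist_a₆,
    Units.val_inv_eq_inv_val, Units.val_mk0, mul_zero, add_zero, zero_mul, sub_zero,
    zero_pow two_ne_zero, zero_pow (by norm_num : (3 : ℕ) ≠ 0)] at h1 h2 h3 h4 h6
  have ha1 : W.a₁ = 0 := by simpa using h1
  have ha3 : W.a₃ = 0 := by simpa using h3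
  refine ⟨ha1, ?_, ha3, ?_, ?_⟩
  · field_simp at h2; linarith
  · field_simp at h4; linarith
  · field_simp at h6; linarith

/-- The integral twist model is an elliptic curve (`d ≠ 0`). [Silverman AEC X.5 Cor. 5.4] [cite: SilvermanAEC2009, X.5 Cor. 5.4] -/
theorem isElliptic_of_scaleTwo_smul_eq [V.IsElliptic] (hd : d ≠ 0)
    (hW : (⟨Units.mk0 (2 : ℚ) two_ne_zero, 0, 0, 0⟩ : VariableChange ℚ) • W = V.quadraticTwist (d : ℚ)) :
    W.IsElliptic := by
  haveI := V.isElliptic_quadraticTwist (d := (d : ℚ)) (by exact_mod_cast hd)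
  have : W = (⟨Units.mk0 (2 : ℚ) two_ne_zero, 0, 0, 0⟩ : VariableChange ℚ)⁻¹ • V.quadraticTwist (d : ℚ) := by
    rw [← hW, ← mul_smul, inv_mul_cancel, one_smul]
  rw [this]
  infer_instance

/-- The integral twist model has coefficients in `ℤ` when `V` does (`d b₂, 8d²b₄, 16d³b₆ ∈ ℤ`).
[Silverman AEC III.1] [cite: SilvermanAEC2009, III.1 Table 3.1] -/
theorem isIntegral_of_scaleTwo_smul_eq [hV : V.IsIntegral ℤ]
    (hW : (⟨Units.mk0 (2 : ℚ) two_ne_zero, 0, 0, 0⟩ : VariableChange ℚ) • W = V.quadraticTwist (d : ℚ)) :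
    W.IsIntegral ℤ := by
  obtain ⟨h1, h2, h3, h4, h6⟩ := V.coeffs_of_scaleTwo_smul_eq d W hW
  obtain ⟨V₀, hV₀⟩ := hV.integral
  have hb₂ : V.b₂ = (V₀.b₂ : ℚ) := by rw [hV₀]; simp [baseChange]
  have hb₄ : V.b₄ = (V₀.b₄ : ℚ) := by rw [hV₀]; simp [baseChange]
  have hb₆ : V.b₆ = (V₀.b₆ : ℚ) := by rw [hV₀]; simp [baseChange]
  refine isIntegral_of_exists_lift ℤ ⟨0, by simp [h1]⟩ ⟨d * V₀.b₂, ?_⟩ ⟨0, by simp [h3]⟩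
    ⟨8 * d ^ 2 * V₀.b₄, ?_⟩ ⟨16 * d ^ 3 * V₀.b₆, ?_⟩
  · rw [h2, hb₂, eq_intCast]; push_cast; ring
  · rw [h4, hb₄, eq_intCast]; push_cast; ring
  · rw [h6, hb₆, eq_intCast]; push_cast; ring

end Model

/-! ### §2 Over a field containing `√d`: the change of variables onto `V` -/

section OverK

variable (V : WeierstrassCurve ℚ) (d : ℤ) (W : WeierstrassCurve ℚ) {K : Type*} [Field K] [CharZero K]

/-- **`(2e, 0, e a₁, 4e³a₃) • W_K = V_K` for `e² = d`**: over any field of characteristic `0`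
containing a square root `e` of `d`, the integral twist model is isomorphic to `V` by the change of
variables `u = 2e`, `r = 0`, `s = e a₁`, `t = 4e³a₃` (`x_V = x_W/(4d)`). [Silverman AEC X.2 Prop. 2.4,
X.5 Cor. 5.4 (twists become isomorphic over `K(√d)`); III.1 Table 3.1] [cite: SilvermanAEC2009, X.5 Cor. 5.4] -/
theorem twist_variableChange_smul_map_eq (hd : d ≠ 0)
    (hW : (⟨Units.mk0 (2 : ℚ) two_ne_zero, 0, 0, 0⟩ : VariableChange ℚ) • W = V.quadraticTwist (d : ℚ))
    (e : K) (he : e ^ 2 = (d : K)) :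
    (⟨Units.mk0 (2 * e) (mul_ne_zero two_ne_zero (by rintro rfl; apply hd; exact_mod_cast (by
        simpa using he.symm : ((d : K)) = 0))),
      0, e * algebraMap ℚ K V.a₁, 4 * e ^ 3 * algebraMap ℚ K V.a₃⟩ : VariableChange K) •
        W.map (algebraMap ℚ K) = V.map (algebraMap ℚ K) := by
  obtain ⟨h1, h2, h3, h4, h6⟩ := V.coeffs_of_scaleTwo_smul_eq d W hW
  have he0 : e ≠ 0 := by
    rintro rfl; apply hd
    have : ((d : ℚ) : K) = 0 := by simpa using he.symm
    exact_mod_cast this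
  have hdK : (algebraMap ℚ K) (d : ℚ) = e ^ 2 := by rw [he, map_intCast]
  ext
  · simp only [variableChange_a₁, map_a₁, h1, map_zero, zero_add, Units.val_inv_eq_inv_val,
      Units.val_mk0]
    field_simp
  · simp only [variableChange_a₂, map_a₁, map_a₂, h1, h2, map_zero, mul_zero, sub_zero, add_zero,
      Units.val_inv_eq_inv_val, Units.val_mk0, map_mul, hdK, b₂, map_add, map_pow, map_ofNat]
    field_simp
    ring
  · simp only [variableChange_a₃, map_a₁, map_a₃, h1, h3, map_zero, mul_zero, zero_add,
      Units.val_inv_eq_inv_val, Units.val_mk0]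
    field_simp
    ring
  · simp only [variableChange_a₄, map_a₁, map_a₂, map_a₃, map_a₄, h1, h3, h4, map_zero, mul_zero,
      sub_zero, add_zero, Units.val_inv_eq_inv_val, Units.val_mk0, map_mul, map_pow, hdK, b₄,
      map_add, map_ofNat, zero_pow two_ne_zero]
    field_simp
    ring
  · simp only [variableChange_a₆, map_a₁, map_a₂, map_a₃, map_a₄, map_a₆, h1, h3, h6, map_zero,
      mul_zero, sub_zero, add_zero, Units.val_inv_eq_inv_val, Units.val_mk0, map_mul, map_pow,
      hdK, b₆, map_add, map_ofNat, zero_pow two_ne_zero, zero_pow (by norm_num : (3 : ℕ) ≠ 0)]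
    field_simp
    ring

end OverK

/-! ### §3 The sigma-squared pair of the integral twist model at a prime `p` -/

section Pair

variable (V : WeierstrassCurve ℚ) [V.IsIntegral ℤ] (d : ℤ) (W : WeierstrassCurve ℚ) (p : ℕ) [Fact p.Prime]

/-- **The integral twist model carries a sigma-squared pair at every prime at which `V` does.** If
`(2,0,0,0) • W = V^{(d)}`, `d ≠ 0`, and `(Σ, c)` is a sigma-squared pair of `V ⊗ ℚ_p` with `x⁻¹`-expansion
`𝔖` (`Σ = 𝔖(1/x)`), then `((4d)⁻¹·𝔖(4d/x_W), 4d·c)` is a sigma-squared pair of `W ⊗ ℚ_p` — even though `W`,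
a quadratic twist, may have ADDITIVE reduction at `p` (`p ∣ 2d`): `PadicSigmaSqTwistTransportProofs`'s
transport run over `K = \overline{ℚ_p} ∋ √d` with `vc = (2√d, 0, √d·a₁, 4√d³·a₃)`, `u² = 4d`.
[Mazur–Tate 1991, §3 and Thm. 3.1; Silverman 2005, §5 Rem. 2] [cite: MazurTate1991, Thm. 3.1]
[cite: Silverman2005DivPoly, §5 Rem. 2] -/
theorem isMazurTateSigmaSqPair_twistModel (hd : d ≠ 0)
    (hW : (⟨Units.mk0 (2 : ℚ) two_ne_zero, 0, 0, 0⟩ : VariableChange ℚ) • W = V.quadraticTwist (d : ℚ))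
    {Sq : ℚ_[p]⟦X⟧} {c : ℚ_[p]} (hpair : (V.baseChange ℚ_[p]).IsMazurTateSigmaSqPair Sq c)
    {S : ℚ_[p]⟦X⟧} (hS : (V.baseChange ℚ_[p]).IsInvXExpansion Sq S) :
    (W.baseChange ℚ_[p]).IsMazurTateSigmaSqPair
      (C (4 * (d : ℚ_[p]))⁻¹ * S.subst (C (4 * (d : ℚ_[p])) * (W.baseChange ℚ_[p]).formalInvX))
      (4 * (d : ℚ_[p]) * c) := by
  haveI : W.IsIntegral ℤ := V.isIntegral_of_scaleTwo_smul_eq d W hW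
  set K := AlgebraicClosure ℚ_[p] with hK
  obtain ⟨e, he⟩ := IsAlgClosed.exists_pow_nat_eq ((d : ℚ) : K) two_pos
  have he' : e ^ 2 = (d : K) := by rw [he, Rat.cast_intCast]
  have hvc := V.twist_variableChange_smul_map_eq d W hd hW e he'
  -- the same change of variables, read over `ℚ_p ⊂ K`
  have hφ : (algebraMap ℚ_[p] K).comp (algebraMap ℚ ℚ_[p]) = algebraMap ℚ K := Subsingleton.elim _ _
  have hWK : (W.baseChange ℚ_[p]).map (algebraMap ℚ_[p] K) = W.map (algebraMap ℚ K) := by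
    rw [baseChange, map_map, hφ]
  have hVK : (V.baseChange ℚ_[p]).map (algebraMap ℚ_[p] K) = V.map (algebraMap ℚ K) := by
    rw [baseChange, map_map, hφ]
  rw [← hWK, ← hVK] at hvc
  have he0 : e ≠ 0 := by
    rintro rfl; apply hd
    have : ((d : ℚ) : K) = 0 := by simpa using he.symm
    exact_mod_cast this
  have h2e : (2 : K) * e ≠ 0 := mul_ne_zero two_ne_zero he0
  have hu : (((Units.mk0 (2 * e) h2e) : Kˣ) : K) ^ 2 = algebraMap ℚ_[p] K (4 * (d : ℚ_[p])) := by
    rw [Units.val_mk0, mul_pow, he', map_mul, map_intCast, map_ofNat]; norm_num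
  have hD : ‖(4 * (d : ℚ_[p]))‖ ≤ 1 := by
    rw [show (4 * (d : ℚ_[p])) = ((4 * d : ℤ) : ℚ_[p]) by push_cast; ring]
    exact Padic.norm_int_le_one _
  exact isMazurTateSigmaSqPair_twistTransport (V.baseChange ℚ_[p]) (W.baseChange ℚ_[p]) _ hvc rfl hu hD hpair hS

/-- **… in particular with `V`'s own `Σ_p` and `𝔖_p`**: if `V ⊗ ℚ_p` has a sigma-squared pair at all (good
ordinary `p`, `p = 2` included; e.g. `cm7Twist_exists_isMazurTateSigmaSqPair_two`), the integral twist model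
`W` carries the pair `((4d)⁻¹·𝔖_p(4d/x_W), 4d·c_p)` with `𝔖_p = padicSigmaSqInvX V p` THE `x⁻¹`-expansion of
`Σ_p = padicSigmaSq (V ⊗ ℚ_p)`. [Mazur–Tate 1991, Thm. 3.1; Silverman 2005, §5 Rem. 2]
[cite: MazurTate1991, Thm. 3.1] [cite: Silverman2005DivPoly, §5 Rem. 2] -/
theorem isMazurTateSigmaSqPair_twistModel_padicSigmaSqInvX (hd : d ≠ 0)
    (hW : (⟨Units.mk0 (2 : ℚ) two_ne_zero, 0, 0, 0⟩ : VariableChange ℚ) • W = V.quadraticTwist (d : ℚ))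
    (hex : ∃ Sq : ℚ_[p]⟦X⟧, ∃ c : ℚ_[p], (V.baseChange ℚ_[p]).IsMazurTateSigmaSqPair Sq c) :
    (W.baseChange ℚ_[p]).IsMazurTateSigmaSqPair
      (C (4 * (d : ℚ_[p]))⁻¹ *
        (V.padicSigmaSqInvX p).subst (C (4 * (d : ℚ_[p])) * (W.baseChange ℚ_[p]).formalInvX))
      (4 * (d : ℚ_[p]) * (V.baseChange ℚ_[p]).padicSigmaSqConst) :=
  V.isMazurTateSigmaSqPair_twistModel d W p hd hW (isMazurTateSigmaSqPair_padicSigmaSq (Or.inr hex))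
    (isInvXExpansion_padicSigmaSqInvX_of_exists_pair (Or.inr hex))

end Pair

/-! ### §4 The value dictionary: `1/x` and the twisted pair at points of `E₁(ℚ_p)` -/

section Values

variable {p : ℕ} [Fact p.Prime] (V₂ : WeierstrassCurve ℚ_[p]) [V₂.IsIntegral ℤ_[p]]

/-- **`(1/x)(z(P)) = 1/x(P)`** for `P = (x, y) ∈ E₁(ℚ_p)` (`p`-integral equation): the series `formalInvX`
evaluates to the reciprocal of the `x`-coordinate (`X̂(z) = x z²`, `(1/x)·X̂ = z²`).
[Silverman AEC IV.1, VII.2.2] [cite: SilvermanAEC2009, IV.1.1] -/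
theorem padicEval_formalInvX_eq {x y : ℚ_[p]} (heq : V₂.toAffine.Equation x y) (hx : 1 < ‖x‖) :
    padicEval V₂.formalInvX (-x / y) = x⁻¹ := by
  obtain ⟨-, hz0, hz1, -, -⟩ := V₂.param_facts heq hx
  have hX := V₂.padicEval_formalXMulSq_eq heq hx
  have hB : padicEval V₂.formalWDivCube (-x / y) * (x * (-x / y) ^ 2) = 1 := by
    rw [← hX, ← padicEval_mul V₂.isPadicInt_formalWDivCube V₂.isPadicInt_formalXMulSq hz1,
      formalWDivCube_mul_formalXMulSq, padicEval_one]
  rw [formalInvX, padicEval_mul (IsPadicInt.powerSeries_X.pow 2) V₂.isPadicInt_formalWDivCube hz1,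
    padicEval_pow IsPadicInt.powerSeries_X hz1, padicEval_X, eq_inv_of_mul_eq_one_left hB]
  have hz2 : (-x / y) ^ 2 ≠ 0 := pow_ne_zero 2 hz0
  calc (-x / y) ^ 2 * (x * (-x / y) ^ 2)⁻¹ = x⁻¹ * ((-x / y) ^ 2 * ((-x / y) ^ 2)⁻¹) := by
        rw [mul_inv]; ring
    _ = x⁻¹ := by rw [mul_inv_cancel₀ hz2, mul_one]

variable {V₂} in
/-- **The twisted pair at a point**: `(λ⁻¹·S(λ/x))(z(P)) = λ⁻¹·S(λ/x(P))` for `P = (x, y) ∈ E₁(ℚ_p)`,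
`S ∈ wℤ_p⟦w⟧`, `λ ∈ ℤ_p`, `λ⁻¹λ = 1`. [Silverman 2005, §5 Rem. 2 (values of `σ²`); AEC VII.2.2]
[cite: Silverman2005DivPoly, §5 Rem. 2] -/
theorem padicEval_rescale_subst_formalInvX_eq {S : ℚ_[p]⟦X⟧} (hS : IsPadicInt S)
    (hS0 : constantCoeff S = 0) {a b : ℚ_[p]} (hab : a * b = 1) (hb : ‖b‖ ≤ 1)
    {x y : ℚ_[p]} (heq : V₂.toAffine.Equation x y) (hx : 1 < ‖x‖) :
    padicEval (C a * S.subst (C b * V₂.formalInvX)) (-x / y) = a * padicEval S (b * x⁻¹) := by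
  obtain ⟨-, hz0, hz1, -, -⟩ := V₂.param_facts heq hx
  have hw := V₂.padicEval_formalInvX_eq heq hx
  have hg0 : constantCoeff (C b * V₂.formalInvX) = 0 := by
    rw [map_mul, constantCoeff_formalInvX, mul_zero]
  have hg : HasSubst (C b * V₂.formalInvX) := HasSubst.of_constantCoeff_zero' hg0
  have hgi : IsPadicInt (C b * V₂.formalInvX) := (IsPadicInt.powerSeries_C hb).mul V₂.isPadicInt_formalInvX
  have hS1 : IsPadicInt (sigmaShift S) := by
    rw [isPadicInt_iff_coeff] at hS ⊢
    intro n; rw [coeff_sigmaShift]; exact hS _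
  have hgval : padicEval (C b * V₂.formalInvX) (-x / y) = b * x⁻¹ := by
    rw [padicEval_mul (IsPadicInt.powerSeries_C hb) V₂.isPadicInt_formalInvX hz1, padicEval_C, hw]
  have ht : ‖b * x⁻¹‖ < 1 := by
    rw [norm_mul, norm_inv]
    calc ‖b‖ * ‖x‖⁻¹ ≤ 1 * ‖x‖⁻¹ := mul_le_mul_of_nonneg_right hb (inv_nonneg.mpr (norm_nonneg _))
      _ < 1 := by rw [one_mul]; exact inv_lt_one_of_one_lt₀ hx
  rw [V₂.rescale_subst_formalInvX_eq S hS0 hab,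
    padicEval_mul V₂.isPadicInt_formalInvX (hS1.powerSeries_subst hgi hg) hz1, hw,
    padicEval_subst hS1 hgi hg0 hz1, hgval]
  conv_rhs => rw [← X_mul_sigmaShift hS0, padicEval_mul IsPadicInt.powerSeries_X hS1 ht, padicEval_X]
  linear_combination (-(x⁻¹ * padicEval (sigmaShift S) (b * x⁻¹))) * hab

end Values

end WeierstrassCurve
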